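import Summits.QuantumFields.YangMills.Theorems.FluctuationComparisonRegPrIntLS2BetaCriticalOrbitUniqueAbelian
import Summits.QuantumFields.YangMills.Theorems.UnitScaleTiltProp7SymCentreAbelianWrap
import Summits.QuantumFields.YangMills.Theorems.UnitScaleTiltProp7NestedMeanParallelLiftDiagSplit
import Summits.QuantumFields.YangMills.Theorems.AlphaInputsT3ACMinimiserPin
import HarnessLib

/-!
# S2β · THE LETTERING-FREE ABELIAN SUPPLIER: an abelian constrained minimiser is E–L-critical along every fibre curve — NO angle lettering, NO loop-sum guards
# (the (0.4) averaging of record is MULTIPLICATIVE on σ₃-diagonal fields inside its guard)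

Cell `ym3-torus` (YM ladder rung R3 = continuum `SU(2)` Yang–Mills on the three-torus at fixed lattice data — a RUNG: NOT d = 4, NOT infinite volume,
NOT a mass gap, NOT Clay).  Width seat `ym3-torus-px12` (gen 21), pen (B) «ABELIAN STRATUM» FILE 5; crux `stmt-QuantumFields-20520`
(`…Theses.UnitScaleTilt.FluctuationComparisonRegPrIntL`), LINE S2β; `--kind proof --supports stmt-QuantumFields-20520 --as helper`: count-neutral, DEFINITION-FREE
(0 `def`, 0 `instance`, 0 `notation`, 0 `sorry`, default heartbeats).

WHY.  ✓FILE 2 `el_of_abelianMin` asked for a lettering `a` of the diagonal minimiser `W = e^{a·iσ₃}` with STRICT loop-sum guards at every averaging level, only because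
✓`iter_blockAvg_gexpAt_of_loopSum_lt` reads the (0.4) average through ONE global lettering (in a non-trivial flux sector no such lettering exists).  The guard is a
property of the loop HOLONOMIES, which are near `1` for every regular `W` whatever the lettering (✓`smallBelow_of_plaqSmall`); and on commuting fields the averaging of
record is MULTIPLICATIVE: `Ū(W·e^{t s·iσ₃}) = Ū(W)·Ū(e^{t s·iσ₃}) = Ū(W)·e^{t·(linAvg04 s)·iσ₃}` for `|t|` small (loop holonomies multiply, principal logarithms of commuting
near-identity diagonal unitaries ADD, axial transports multiply).  So along a diagonal direction `Ū^k(W·e^{t s·iσ₃}) = Ū^k(W)·e^{t·(linAvgIter k s)·iσ₃}` WITHOUT any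
lettering of `W`, and FILE 2's Fermat argument runs verbatim: the lettering and the guards DISAPPEAR from the abelian letter EX^{ab}.

WHAT (`SU(2)`, generic torus `P` in §1–§2, `F : T3Family` in §3).
* §1 `corr_eq_gexp_of_coe_loopHol` — the (0.4) correction factor of a σ₃-diagonal field from ANY `δ₂`-small angle representatives of its loop holonomies;
  `exists_small_angle` — every `e^{θ·iσ₃}` is `e^{φ·iσ₃}` with `|φ| ≤ (π∕2)·dist1(e^{θ·iσ₃})` (flux absorbed into the representative).
* §2 `axialSum_add_smul`; ★★`avgFun_gexpAt_add_smul_eventually` — one level: for ANY lettering `a` whose level-`(j+1)` loop holonomies are in the guard and any one-form `s`,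
  `Ū(e^{a·iσ₃})(c) = e^{θ·iσ₃}` for some `θ`, and for `t` near `0`, `Ū(e^{(a + t s)·iσ₃})(c) = Ū(e^{a·iσ₃})(c)·e^{t·linAvg04 s(c)·iσ₃}`;
  ★★`iter_gexpAt_add_smul_eventually` — all levels under `SmallBelow k (e^{a·iσ₃})` only.
* §3 ★★`abelianTangentCritical_of_abelianMin_free`; ★★★`el_of_abelianMin_free (hW : W σ₃-diagonal) (hreg : W ∈ regFibrePr F n K h e V) (hmin : minimal among the σ₃-diagonal
  members) (+ the two admissibility rows `143·(49∕4)²·e ≤ 1∕3`, `2e ≤ 2δ₂∕(7L)²`)` : ✓`orbitGrowth_of_regular_five`'s ∕ ✓pen 7's `hEL` binder at `W` — NO lettering, NO guards.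

THE ONE DISPLAYED LETTER DOWNSTREAM (desk №303∕№312, names fixed for the funnel).  EX^{ab}′ := «∃ W σ₃-diagonal, W ∈ regFibrePr F n K e V, A(W) ≤ A(W′) for every σ₃-diagonal
W′ ∈ regFibrePr F n K e V» — the HYPOTHESES `hW`, `hreg`, `hmin` of §3, carried as hypotheses (this file supplies `hEL` FROM them; it does not produce `W`).  EX^{ab}′ ⟸
{✓`diagonalLift_abelian` (a σ₃-diagonal regular member exists), compactness of the closed diagonal fibre, REG^{ab}}, where REG^{ab} := «a minimiser of A over the CLOSED
σ₃-diagonal (6)(e)-fibre is strictly (6)(e)-regular» = the sup-norm regularity of the constrained abelian minimiser ([Balaban1985Variational] Prop. 7 p.299 with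
[Balaban1984PropagatorsI]-type decay) — REG^{ab} is NOT claimed, NOT proved, and NOT a hypothesis of any theorem here; it is named only so the funnel reads one letter.

HONEST.  Kinematics of the tree's own averaging on the diagonal torus; the abelian minimiser's EXISTENCE (EX^{ab}′: a σ₃-diagonal member of `regFibrePr F n K e V` minimising
among the σ₃-diagonal members) stays a HYPOTHESIS; nothing of Bałaban's analysis asserted; Prop. 7 cl. 1's EX^{ab}′ editions are the sibling file; (E), ISOL∘, TUBE-REG∘,
GAP♯∘, EXW∘, S2β and crux 20520 NOT proved; rung R3 = `YM3TorusSU2` as filed — SU(2) YM₃ on T³; the Yang–Mills mass gap is NOT proved.  Sorry-free, axioms standard.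
[cite: Balaban1987RG1, (0.4) and (0.11) p.253; Balaban1985Averaging, (9), (11), (19)-(24) pp.19-21, (52)-(54) p.26; Balaban1985Variational, (2)-(6) p.278, (111) p.294, Prop. 7 p.299]
-/

set_option autoImplicit false

noncomputable section

open scoped Matrix.Norms.L2Operator Topology BigOperators
open Filter Function NormedSpace
open Literature.MathematicalPhysics.QuantumFieldTheory.Balaban1983to89
open Literature.MathematicalPhysics.QuantumFieldTheory.Balaban1983to89.T4Continuum
open Literature.MathematicalPhysics.QuantumFieldTheory.Balaban1983to89.BlockAveraging (blockAvg Idx loopHol corr avgFun blockAvg_avg)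
open Literature.MathematicalPhysics.QuantumFieldTheory.Balaban1983to89.ExpMeanLog (expMeanLogSU deltaSU coe_ESU_of_small eml_eq_exp_sum)
open Literature.MathematicalPhysics.QuantumFieldTheory.Balaban1983to89.T4AdjointCovarianceUnitary (lieSU)
open Literature.MathematicalPhysics.QuantumFieldTheory.Balaban1983to89.B9AdOrthogonal (σ₃)
open Literature.MathematicalPhysics.QuantumFieldTheory.Balaban1983to89.Node00
open Literature.MathematicalPhysics.QuantumFieldTheory.Balaban1983to89.T3ContinuumYM3Torus
open Literature.MathematicalPhysics.QuantumFieldTheory.Balaban1983to89.T3UnitLawDensityEML (ℰp)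
open Literature.MathematicalPhysics.QuantumFieldTheory.Balaban1983to89.T3TiltDescent (descendTo)
open Literature.MathematicalPhysics.QuantumFieldTheory.Balaban1983to89.T3ConstrainedMinimiser (fibre)
open Literature.MathematicalPhysics.QuantumFieldTheory.Balaban1983to89.T3PrintedRegularMinimiser
open Literature.MathematicalPhysics.QuantumFieldTheory.Balaban1983to89.T3LevelShift (fieldShift fieldShift_fieldShift_symm)
open Summit.QuantumFields.Balaban3D.Carriers (suGroupModel)
open Summit.QuantumFields.YangMills.Theorems.BlockAvgCorrector (stokesConst)
open Summit.QuantumFields.YangMills.Theorems.BalabanUVNodesN08AlphaAbelianLift (gexp gexp_add mlog_exp_real_smul)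
open Summit.QuantumFields.YangMills.Theorems.AbelianEML
  (gexpAt linAvgIter loopSum axialSum linAvg04 coe_gexp_su linAvgIter_succ real_smul_ofReal_smul loopHol_gexpAt axialAvg_gexpAt dist1_gexp)
open Summit.QuantumFields.YangMills.Theorems.Prop7SymCentreAbelianDict (I_smul_sigma3_mem_lie)
open Summit.QuantumFields.YangMills.Theorems.Prop7SymCentreAbelianFibre
  (I_smul_sigma3_ne_zero norm_I_smul_sigma3 commute_coe_gexpAt_sigma3 exists_eq_gexpAt_of_forall_commute_sigma3 gexp_I_smul_sigma3_add_two_pi_mul_int)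
open Summit.QuantumFields.YangMills.Theorems.Prop7NestedMeanParallelLiftDiagGauge (exists_int_abs_sub_two_pi_mul_le_of_norm_exp_sigma3)
open Summit.QuantumFields.YangMills.Theorems.AvgActionDefect (deltaSU_fin_two)
open Summit.QuantumFields.YangMills.Theorems.Prop8Criticality (exists_ball_subset_regPr)
open Summit.QuantumFields.YangMills.BalabanUVNodes.N07CritTangentConverse (smallBelow_of_plaqSmall)
open Summit.QuantumFields.YangMills.Theorems.FluctuationComparisonRegPrIntLS2BetaAbelianSymmetricCriticality (curveCritical_of_abelianTangentCritical)
open Summit.QuantumFields.YangMills.Theorems.FluctuationComparisonRegPrIntLS2BetaAbelianCriticalOfMin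
  (exists_coe_eq_smul_of_commute_sigma3 loopSum_add_smul expChart_gexpAt_eq)
open Summit.QuantumFields.YangMills.Theorems.FluctuationComparisonRegPrIntLS2BetaCriticalOrbitUniqueAbelian (smallness_of_regPr)

namespace Summit.QuantumFields.YangMills.Theorems.FluctuationComparisonRegPrIntLS2BetaAbelianCriticalOfMinFree

/-! ## §1 The correction factor from small angle representatives; angle representatives of diagonal near-identity elements -/

section Corr

variable {P : Params} {j : ℕ}

/-- **THE (0.4) CORRECTION FACTOR OF A FAMILY OF DIAGONAL LOOP VARIABLES IS `e^{(mean φ)·iσ₃}` FOR ANY SMALL ANGLE REPRESENTATIVES `φ_i`** (`↑(loop_i) = e^{φ_i·iσ₃}`,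
`|φ_i| < log 2`, the loops on the guard) — ✓`AbelianEML.corr_gexpAt`'s proof, lettering-free. [cite: Balaban1987RG1, (0.4) p.253; Balaban1985Averaging, (21) p.21] -/
theorem corr_eq_gexp_of_coe_loopHol (W : GaugeField P j (Matrix.specialUnitaryGroup (Fin 2) ℂ)) (c : PBond P (j + 1)) (φ : Idx P → ℝ)
    (hW : ∀ i, ((loopHol W c i : Matrix.specialUnitaryGroup (Fin 2) ℂ) : Matrix (Fin 2) (Fin 2) ℂ) = NormedSpace.exp ((((φ i : ℝ)) : ℂ) • (Complex.I • σ₃ : Matrix (Fin 2) (Fin 2) ℂ)))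
    (hδ : ∀ i, dist1 (loopHol W c i) < deltaSU (Fin 2)) (hlog : ∀ i, |φ i| * ‖(Complex.I • σ₃ : Matrix (Fin 2) (Fin 2) ℂ)‖ < Real.log 2) :
    corr (expMeanLogSU (n := Fin 2)) W c = gexp (suGroupModel 2) I_smul_sigma3_mem_lie ((Fintype.card (Idx P) : ℝ)⁻¹ * ∑ i, φ i) := by
  have hsm : BlockAveraging.Small (expMeanLogSU (n := Fin 2)) W c := hδ
  unfold corr
  rw [if_pos hsm]
  have hguard : ∀ i : Fin (Fintype.card (Idx P) - 1 + 1), ‖(((loopHol W c ∘ (LoopAverage.enum (Idx P)).symm) i : Matrix.specialUnitaryGroup (Fin 2) ℂ) :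
      Matrix (Fin 2) (Fin 2) ℂ) - 1‖ < deltaSU (Fin 2) := fun i => hδ _
  apply Subtype.ext
  show (((expMeanLogSU (n := Fin 2)).E (loopHol W c ∘ (LoopAverage.enum (Idx P)).symm) : Matrix.specialUnitaryGroup (Fin 2) ℂ) : Matrix (Fin 2) (Fin 2) ℂ) = _
  rw [show (expMeanLogSU (n := Fin 2)).E (loopHol W c ∘ (LoopAverage.enum (Idx P)).symm) = ExpMeanLog.ESU (loopHol W c ∘ (LoopAverage.enum (Idx P)).symm) from rfl,
    coe_ESU_of_small hguard, eml_eq_exp_sum, coe_gexp_su]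
  congr 1
  have hlog' : ∀ i : Fin (Fintype.card (Idx P) - 1 + 1),
      MatrixLog.mlog ((((loopHol W c ∘ (LoopAverage.enum (Idx P)).symm) i : Matrix.specialUnitaryGroup (Fin 2) ℂ) : Matrix (Fin 2) (Fin 2) ℂ)) =
        (((φ ((LoopAverage.enum (Idx P)).symm i) : ℝ)) : ℂ) • (Complex.I • σ₃ : Matrix (Fin 2) (Fin 2) ℂ) := by
    intro i
    rw [Function.comp_apply, hW, mlog_exp_real_smul (hlog _)]
  simp_rw [hlog', Fintype.card_fin, real_smul_ofReal_smul, ← Finset.sum_smul, ← Complex.ofReal_sum]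
  congr 2
  have hcard : Fintype.card (Idx P) - 1 + 1 = Fintype.card (Idx P) := Nat.sub_add_cancel Fintype.card_pos
  have hc' : ((Fintype.card (Idx P) - 1 + 1 : ℕ) : ℝ) = ((Fintype.card (Idx P) : ℕ) : ℝ) := by exact_mod_cast hcard
  rw [Finset.mul_sum, show (∑ i : Fin (Fintype.card (Idx P) - 1 + 1), ((Fintype.card (Idx P) - 1 + 1 : ℕ) : ℝ)⁻¹ * φ ((LoopAverage.enum (Idx P)).symm i)) =
      ∑ i : Fin (Fintype.card (Idx P) - 1 + 1), (fun k : Idx P => ((Fintype.card (Idx P) : ℕ) : ℝ)⁻¹ * φ k) ((LoopAverage.enum (Idx P)).symm i) by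
    refine Finset.sum_congr rfl fun i _ => ?_; beta_reduce; rw [hc']]
  exact Equiv.sum_comp (LoopAverage.enum (Idx P)).symm (fun k : Idx P => ((Fintype.card (Idx P) : ℕ) : ℝ)⁻¹ * φ k)

/-- **A SMALL ANGLE REPRESENTATIVE**: a real `θ` with `‖e^{θ·iσ₃} − 1‖ < ⅓` is `φ + 2πm` with `|φ| ≤ (π∕2)·‖e^{θ·iσ₃} − 1‖` (✓`exists_int_abs_sub_two_pi_mul_le_of_norm_exp_sigma3`),
and `e^{φ·iσ₃} = e^{θ·iσ₃}`. [folklore] -/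
theorem exists_small_angle (θ : ℝ) :
    ∃ φ : ℝ, gexp (suGroupModel 2) I_smul_sigma3_mem_lie φ = gexp (suGroupModel 2) I_smul_sigma3_mem_lie θ ∧
      |φ| ≤ Real.pi / 2 * dist1 (gexp (suGroupModel 2) I_smul_sigma3_mem_lie θ) := by
  obtain ⟨m, hm⟩ := exists_int_abs_sub_two_pi_mul_le_of_norm_exp_sigma3 (c := θ) (ε := dist1 (gexp (suGroupModel 2) I_smul_sigma3_mem_lie θ))
    (le_of_eq (dist1_gexp (suGroupModel 2) I_smul_sigma3_mem_lie θ).symm)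
  refine ⟨θ - 2 * Real.pi * m, ?_, hm⟩
  have h := gexp_I_smul_sigma3_add_two_pi_mul_int (θ - 2 * Real.pi * m) m
  rw [sub_add_cancel] at h
  exact h.symm

end Corr

/-! ## §2 Multiplicativity of the averaging of record on the diagonal torus -/

section Mult

variable {P : Params} {j : ℕ}

/-- Linearity of an axial sum along an affine line of one-forms. [cite: Balaban1987RG1, (0.4) p.253] -/
theorem axialSum_add_smul (a s : PBond P j → ℝ) (t : ℝ) (c : PBond P (j + 1)) :
    axialSum (a + t • s) c = axialSum a c + t * axialSum s c := by
  have hsm : t • s = fun b => t * s b := by funext b; simp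
  unfold axialSum
  rw [AbelianEML.wsum_add, hsm, AbelianEML.wsum_smul]

/-- ★★ **ONE LEVEL: `Ū(e^{(a + t s)·iσ₃})(c) = Ū(e^{a·iσ₃})(c) · e^{t·linAvg04 s(c)·iσ₃}` FOR `t` NEAR `0`, AND `Ū(e^{a·iσ₃})(c)` IS σ₃-DIAGONAL** — for ANY lettering `a`
whose level-`j` loop holonomies are `⅓`-small at `c` (no loop-SUM guard: the angle representatives of §1 absorb the flux). [cite: Balaban1987RG1, (0.4) p.253; Balaban1985Averaging, (9), (21) pp.19-21] -/
theorem avgFun_gexpAt_add_smul_eventually (a s : PBond P j → ℝ) (c : PBond P (j + 1))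
    (hsmall : BlockAveraging.Small (expMeanLogSU (n := Fin 2)) (gexpAt (suGroupModel 2) I_smul_sigma3_mem_lie a) c) :
    (∃ θ : ℝ, avgFun (expMeanLogSU (n := Fin 2)) (gexpAt (suGroupModel 2) I_smul_sigma3_mem_lie a) c = gexp (suGroupModel 2) I_smul_sigma3_mem_lie θ) ∧
    ∀ᶠ t in 𝓝 (0 : ℝ), avgFun (expMeanLogSU (n := Fin 2)) (gexpAt (suGroupModel 2) I_smul_sigma3_mem_lie (a + t • s)) c =
      avgFun (expMeanLogSU (n := Fin 2)) (gexpAt (suGroupModel 2) I_smul_sigma3_mem_lie a) c * gexp (suGroupModel 2) I_smul_sigma3_mem_lie (t * linAvg04 s c) := by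
  -- small angle representatives of the loop holonomies of `e^{a·iσ₃}`
  choose φ hφeq hφle using fun i => exists_small_angle (loopSum a c i)
  have hδ3 : deltaSU (Fin 2) = 1 / 3 := deltaSU_fin_two
  have hφlt : ∀ i, |φ i| < Real.pi / 6 := by
    intro i
    have hd : dist1 (gexp (suGroupModel 2) I_smul_sigma3_mem_lie (loopSum a c i)) < 1 / 3 := by
      rw [← loopHol_gexpAt, ← hδ3]; exact hsmall i
    nlinarith [Real.pi_pos, hφle i]
  have hlog2 := Real.log_two_gt_d9; have hpi := Real.pi_lt_d2
  -- the level-`j` loop holonomies of `e^{(a + t s)·iσ₃}` are `e^{(φ_i + t·loopSum s)·iσ₃}`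
  have hloop : ∀ (t : ℝ) (i : Idx P), loopHol (gexpAt (suGroupModel 2) I_smul_sigma3_mem_lie (a + t • s)) c i =
      gexp (suGroupModel 2) I_smul_sigma3_mem_lie (φ i + t * loopSum s c i) := by
    intro t i
    rw [loopHol_gexpAt, loopSum_add_smul, ← gexp_add, ← gexp_add, hφeq]
  -- the two guards along the line: the principal-log window and the (0.4) guard, both OPEN conditions, true at `t = 0`
  have hdist0 : ∀ i : Idx P, dist1 (gexp (suGroupModel 2) I_smul_sigma3_mem_lie (φ i)) < deltaSU (Fin 2) := by
    intro i; rw [hφeq, ← loopHol_gexpAt]; exact hsmall i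
  have hcont : ∀ i : Idx P, Continuous fun t : ℝ => dist1 (gexp (suGroupModel 2) I_smul_sigma3_mem_lie (φ i + t * loopSum s c i)) := by
    intro i
    have h : (fun t : ℝ => dist1 (gexp (suGroupModel 2) I_smul_sigma3_mem_lie (φ i + t * loopSum s c i))) =
        fun t : ℝ => ‖NormedSpace.exp ((((φ i + t * loopSum s c i : ℝ)) : ℂ) • (Complex.I • σ₃ : Matrix (Fin 2) (Fin 2) ℂ)) - 1‖ := by
      funext t; exact dist1_gexp (suGroupModel 2) I_smul_sigma3_mem_lie _
    rw [h]
    letI : NormedAlgebra ℚ (Matrix (Fin 2) (Fin 2) ℂ) := NormedAlgebra.restrictScalars ℚ ℂ (Matrix (Fin 2) (Fin 2) ℂ)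
    refine Continuous.norm (Continuous.sub ?_ continuous_const)
    exact NormedSpace.exp_continuous.comp ((Complex.continuous_ofReal.comp (by fun_prop)).smul continuous_const)
  have hev : ∀ᶠ t in 𝓝 (0 : ℝ), ∀ i : Idx P, |φ i + t * loopSum s c i| < Real.log 2 ∧
      dist1 (gexp (suGroupModel 2) I_smul_sigma3_mem_lie (φ i + t * loopSum s c i)) < deltaSU (Fin 2) := by
    refine eventually_all.2 fun i => (Filter.Eventually.and ?_ ?_)
    · have hc : Continuous fun t : ℝ => |φ i + t * loopSum s c i| := by fun_prop
      refine hc.continuousAt.eventually_lt continuousAt_const ?_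
      have := hφlt i
      simp only [zero_mul, add_zero]
      linarith
    · refine (hcont i).continuousAt.eventually_lt continuousAt_const ?_
      simpa using hdist0 i
  have h0cond : ∀ i : Idx P, |φ i + 0 * loopSum s c i| < Real.log 2 ∧
      dist1 (gexp (suGroupModel 2) I_smul_sigma3_mem_lie (φ i + 0 * loopSum s c i)) < deltaSU (Fin 2) := fun i => by
    simp only [zero_mul, add_zero]; exact ⟨by have := hφlt i; linarith, hdist0 i⟩
  -- the correction factor at `t`
  have hcorr : ∀ t : ℝ, (∀ i : Idx P, |φ i + t * loopSum s c i| < Real.log 2 ∧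
      dist1 (gexp (suGroupModel 2) I_smul_sigma3_mem_lie (φ i + t * loopSum s c i)) < deltaSU (Fin 2)) →
      corr (expMeanLogSU (n := Fin 2)) (gexpAt (suGroupModel 2) I_smul_sigma3_mem_lie (a + t • s)) c =
        gexp (suGroupModel 2) I_smul_sigma3_mem_lie ((Fintype.card (Idx P) : ℝ)⁻¹ * ∑ i, (φ i + t * loopSum s c i)) := by
    intro t ht
    refine corr_eq_gexp_of_coe_loopHol _ c (fun i => φ i + t * loopSum s c i) (fun i => by rw [hloop t i, coe_gexp_su]) (fun i => ?_) (fun i => ?_)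
    · rw [hloop t i]; exact (ht i).2
    · rw [norm_I_smul_sigma3, mul_one]; exact (ht i).1
  refine ⟨⟨(Fintype.card (Idx P) : ℝ)⁻¹ * ∑ i, φ i + axialSum a c, ?_⟩, hev.mono fun t ht => ?_⟩
  · unfold avgFun
    have h0 := hcorr 0 h0cond
    simp only [zero_mul, add_zero, zero_smul] at h0
    rw [h0, axialAvg_gexpAt, gexp_add]
  · unfold avgFun
    have h0 := hcorr 0 h0cond
    simp only [zero_mul, add_zero, zero_smul] at h0
    rw [hcorr t ht, h0, axialAvg_gexpAt, axialAvg_gexpAt, gexp_add, gexp_add, gexp_add]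
    congr 1
    rw [axialSum_add_smul, Finset.sum_add_distrib, mul_add]
    unfold linAvg04
    rw [← Finset.mul_sum]
    ring

/-- ★★ **ALL LEVELS: `Ū^k(e^{(a + t s)·iσ₃}) = Ū^k(e^{a·iσ₃}) · e^{t·(linAvgIter k s)·iσ₃}` FOR `t` NEAR `0`, AND `Ū^k(e^{a·iσ₃})` IS σ₃-DIAGONAL** — under the (0.4) guard
`SmallBelow k` of the base field only (any lettering `a`, no loop-sum guard). [cite: Balaban1987RG1, (0.4)+(0.11) p.253; Balaban1985Averaging, (9), (21) pp.19-21] -/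
theorem iter_gexpAt_add_smul_eventually :
    ∀ (k : ℕ) (a s : PBond P 0 → ℝ),
      SmallBelow (fun j => blockAvg (P := P) (j := j) (expMeanLogSU (n := Fin 2))) k (gexpAt (suGroupModel 2) I_smul_sigma3_mem_lie a) →
      (∃ θ : PBond P k → ℝ, Averaging.iter (fun j => blockAvg (P := P) (j := j) (expMeanLogSU (n := Fin 2))) k (gexpAt (suGroupModel 2) I_smul_sigma3_mem_lie a) =
          gexpAt (suGroupModel 2) I_smul_sigma3_mem_lie θ) ∧
      ∀ᶠ t in 𝓝 (0 : ℝ), Averaging.iter (fun j => blockAvg (P := P) (j := j) (expMeanLogSU (n := Fin 2))) k (gexpAt (suGroupModel 2) I_smul_sigma3_mem_lie (a + t • s)) =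
        fun c => Averaging.iter (fun j => blockAvg (P := P) (j := j) (expMeanLogSU (n := Fin 2))) k (gexpAt (suGroupModel 2) I_smul_sigma3_mem_lie a) c *
          gexp (suGroupModel 2) I_smul_sigma3_mem_lie (t * linAvgIter k s c)
  | 0, a, s, _ => by
    refine ⟨⟨a, rfl⟩, Filter.Eventually.of_forall fun t => ?_⟩
    funext c
    show gexp (suGroupModel 2) I_smul_sigma3_mem_lie ((a + t • s) c) = gexp (suGroupModel 2) I_smul_sigma3_mem_lie (a c) * gexp (suGroupModel 2) I_smul_sigma3_mem_lie (t * s c)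
    rw [gexp_add]; rfl
  | k + 1, a, s, hsm => by
    obtain ⟨⟨θ, hθ⟩, hev⟩ := iter_gexpAt_add_smul_eventually k a s (hsm.mono (Nat.le_succ k))
    -- the level-`k` field is `e^{θ·iσ₃}`, with `⅓`-small loops at every level-`(k+1)` bond
    have hsmall : ∀ c : PBond P (k + 1), BlockAveraging.Small (expMeanLogSU (n := Fin 2)) (gexpAt (suGroupModel 2) I_smul_sigma3_mem_lie θ) c := by
      intro c; rw [← hθ]; exact hsm k (Nat.lt_succ_self k) c
    have hone := fun c : PBond P (k + 1) => avgFun_gexpAt_add_smul_eventually θ (linAvgIter k s) c (hsmall c)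
    choose θ' hθ' using fun c => (hone c).1
    refine ⟨⟨θ', funext fun c => ?_⟩, ?_⟩
    · show (blockAvg (P := P) (j := k) (expMeanLogSU (n := Fin 2))).avg (Averaging.iter _ k _) c = _
      rw [blockAvg_avg, hθ, hθ' c]; rfl
    · have hall : ∀ᶠ t in 𝓝 (0 : ℝ), ∀ c : PBond P (k + 1),
          avgFun (expMeanLogSU (n := Fin 2)) (gexpAt (suGroupModel 2) I_smul_sigma3_mem_lie (θ + t • linAvgIter k s)) c =
            avgFun (expMeanLogSU (n := Fin 2)) (gexpAt (suGroupModel 2) I_smul_sigma3_mem_lie θ) c * gexp (suGroupModel 2) I_smul_sigma3_mem_lie (t * linAvg04 (linAvgIter k s) c) :=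
        eventually_all.2 fun c => (hone c).2
      refine (hev.and hall).mono fun t ht => ?_
      funext c
      show (blockAvg (P := P) (j := k) (expMeanLogSU (n := Fin 2))).avg (Averaging.iter _ k _) c = (blockAvg (P := P) (j := k) (expMeanLogSU (n := Fin 2))).avg (Averaging.iter _ k _) c * _
      rw [blockAvg_avg, ht.1, hθ]
      have hfield : (fun c => gexpAt (suGroupModel 2) I_smul_sigma3_mem_lie θ c * gexp (suGroupModel 2) I_smul_sigma3_mem_lie (t * linAvgIter k s c)) =
          gexpAt (suGroupModel 2) I_smul_sigma3_mem_lie (θ + t • linAvgIter k s) := by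
        funext c
        show gexp (suGroupModel 2) I_smul_sigma3_mem_lie (θ c) * gexp (suGroupModel 2) I_smul_sigma3_mem_lie (t * linAvgIter k s c) =
          gexp (suGroupModel 2) I_smul_sigma3_mem_lie ((θ + t • linAvgIter k s) c)
        rw [gexp_add]; rfl
      rw [hfield, ht.2 c, linAvgIter_succ]

end Mult

/-! ## §3 The lettering-free abelian Euler–Lagrange supplier -/

section Supplier

variable (F : T3Family) {n K : ℕ}

/-- ★★ **THE ABELIAN TANGENT CONDITION, LETTERING-FREE.**  `W` σ₃-diagonal with `t₀`-small iterated averages (`stokesConst·t₀ < δ₂`), `W ∈ regFibrePr F n K e V` minimising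
the Wilson action among the σ₃-DIAGONAL members of `regFibrePr F n K e V`: then `d∕dt A(W·e^{tX})|₀ = 0` for every σ₃-diagonal kernel direction `X` of the linearised
`(K−n)`-fold averaging (✓FILE 1's `habel`).  Proof = ✓FILE 2's, with §2's multiplicative formula in place of the global lettering. [cite: Balaban1985Variational, (2)-(6) p.278, (111) p.294; Balaban1987RG1, (0.4)+(0.11) p.253] -/
theorem abelianTangentCritical_of_abelianMin_free (h : n ≤ K) {e t₀ : ℝ} (ht₀ : 0 < t₀) (hstδ : stokesConst (F.P K) * t₀ < deltaSU (Fin 2))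
    {V : GaugeField (F.P n) 0 (Matrix.specialUnitaryGroup (Fin 2) ℂ)} {W : GaugeField (F.P K) 0 (Matrix.specialUnitaryGroup (Fin 2) ℂ)}
    (hW : ∀ b, Commute ((W b : Matrix.specialUnitaryGroup (Fin 2) ℂ) : Matrix (Fin 2) (Fin 2) ℂ) σ₃)
    (hsm : ∀ i, i < K - n → PlaqSmall t₀ (Averaging.iter (fun i => blockAvg (P := F.P K) (j := i) (expMeanLogSU (n := Fin 2))) i W))
    (hreg : W ∈ regFibrePr F n K h e V)
    (hmin : ∀ W' : GaugeField (F.P K) 0 (Matrix.specialUnitaryGroup (Fin 2) ℂ),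
      (∀ b, Commute ((W' b : Matrix.specialUnitaryGroup (Fin 2) ℂ) : Matrix (Fin 2) (Fin 2) ℂ) σ₃) → W' ∈ regFibrePr F n K h e V → wilsonAction4 W ≤ wilsonAction4 W') :
    ∀ X : PBond (F.P K) 0 → lieSU (Fin 2), (∀ b, Commute ((X b : lieSU (Fin 2)) : Matrix (Fin 2) (Fin 2) ℂ) σ₃) →
      (∀ c : PBond (F.P K) (K - n), HasDerivAt (fun t : ℝ => ((Averaging.iter (fun i => blockAvg (P := F.P K) (j := i) (expMeanLogSU (n := Fin 2))) (K - n)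
        (expChart W (t • X)) c : Matrix.specialUnitaryGroup (Fin 2) ℂ) : Matrix (Fin 2) (Fin 2) ℂ)) 0 0) →
      HasDerivAt (fun t : ℝ => wilsonAction4 (expChart W (t • X))) 0 0 := by
  intro X hXdiag hXker
  obtain ⟨a, rfl⟩ := exists_eq_gexpAt_of_forall_commute_sigma3 W hW
  set U : GaugeField (F.P K) 0 (Matrix.specialUnitaryGroup (Fin 2) ℂ) := gexpAt (suGroupModel 2) I_smul_sigma3_mem_lie a with hU
  choose s hs using fun b => exists_coe_eq_smul_of_commute_sigma3 (X b) (hXdiag b)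
  have hray : ∀ t : ℝ, expChart U (t • X) = gexpAt (suGroupModel 2) I_smul_sigma3_mem_lie (a + t • s) := expChart_gexpAt_eq a s X hs
  have hsb : SmallBelow (fun j => blockAvg (P := F.P K) (j := j) (expMeanLogSU (n := Fin 2))) (K - n) U := smallBelow_of_plaqSmall ht₀ hstδ hsm
  obtain ⟨-, hiter⟩ := iter_gexpAt_add_smul_eventually (P := F.P K) (K - n) a s hsb
  have hiter' : ∀ᶠ t in 𝓝 (0 : ℝ), Averaging.iter (fun i => blockAvg (P := F.P K) (j := i) (expMeanLogSU (n := Fin 2))) (K - n) (expChart U (t • X)) =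
      fun c => Averaging.iter (fun i => blockAvg (P := F.P K) (j := i) (expMeanLogSU (n := Fin 2))) (K - n) U c *
        gexp (suGroupModel 2) I_smul_sigma3_mem_lie (t * linAvgIter (K - n) s c) :=
    hiter.mono fun t ht => by rw [hray t]; exact ht
  -- the kernel condition forces `linAvgIter (K − n) s = 0`
  have hB : linAvgIter (K - n) s = 0 := by
    funext c
    set G := Averaging.iter (fun i => blockAvg (P := F.P K) (j := i) (expMeanLogSU (n := Fin 2))) (K - n) U c with hG
    set B : ℝ := linAvgIter (K - n) s c with hB'
    have hfun : ∀ᶠ t in 𝓝 (0 : ℝ), ((Averaging.iter (fun i => blockAvg (P := F.P K) (j := i) (expMeanLogSU (n := Fin 2))) (K - n)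
        (expChart U (t • X)) c : Matrix.specialUnitaryGroup (Fin 2) ℂ) : Matrix (Fin 2) (Fin 2) ℂ) =
        ((G : Matrix.specialUnitaryGroup (Fin 2) ℂ) : Matrix (Fin 2) (Fin 2) ℂ) * NormedSpace.exp (t • (((B : ℝ) : ℂ) • (Complex.I • σ₃ : Matrix (Fin 2) (Fin 2) ℂ))) := by
      refine hiter'.mono fun t ht => ?_
      rw [ht, Submonoid.coe_mul, coe_gexp_su I_smul_sigma3_mem_lie (t * B), ← real_smul_ofReal_smul]
    have hexp : HasDerivAt (fun t : ℝ => ((G : Matrix.specialUnitaryGroup (Fin 2) ℂ) : Matrix (Fin 2) (Fin 2) ℂ) *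
        NormedSpace.exp (t • (((B : ℝ) : ℂ) • (Complex.I • σ₃ : Matrix (Fin 2) (Fin 2) ℂ))))
        (((G : Matrix.specialUnitaryGroup (Fin 2) ℂ) : Matrix (Fin 2) (Fin 2) ℂ) *
          (NormedSpace.exp ((0 : ℝ) • (((B : ℝ) : ℂ) • (Complex.I • σ₃ : Matrix (Fin 2) (Fin 2) ℂ))) * (((B : ℝ) : ℂ) • (Complex.I • σ₃ : Matrix (Fin 2) (Fin 2) ℂ)))) 0 :=
      (hasDerivAt_exp_smul_const (𝕂 := ℝ) (((B : ℝ) : ℂ) • (Complex.I • σ₃ : Matrix (Fin 2) (Fin 2) ℂ)) 0).const_mul _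
    rw [zero_smul, NormedSpace.exp_zero, one_mul] at hexp
    have hder := hexp.congr_of_eventuallyEq hfun
    have hzero := (hXker c).unique hder
    have hunit : star ((G : Matrix.specialUnitaryGroup (Fin 2) ℂ) : Matrix (Fin 2) (Fin 2) ℂ) * ((G : Matrix.specialUnitaryGroup (Fin 2) ℂ) : Matrix (Fin 2) (Fin 2) ℂ) = 1 :=
      G.2.1.1
    have hsmul : (((B : ℝ) : ℂ) • (Complex.I • σ₃ : Matrix (Fin 2) (Fin 2) ℂ)) = 0 := by
      have h := congrArg (fun M => star ((G : Matrix.specialUnitaryGroup (Fin 2) ℂ) : Matrix (Fin 2) (Fin 2) ℂ) * M) hzero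
      rw [mul_zero, ← mul_assoc, hunit, one_mul] at h
      exact h.symm
    have hBz : ((B : ℝ) : ℂ) = 0 := by
      rcases smul_eq_zero.mp hsmul with hB0 | hY
      · exact hB0
      · exact absurd hY I_smul_sigma3_ne_zero
    exact_mod_cast hBz
  -- so the line stays in the fibre …
  have hV : V = descendTo F ℰp n K h U := ((mem_regFibrePr_iff F).mp hreg).1.symm
  have hfib : ∀ᶠ t in 𝓝 (0 : ℝ), expChart U (t • X) ∈ fibre F ℰp n K h V := by
    refine hiter'.mono fun t ht => ?_
    show descendTo F ℰp n K h (expChart U (t • X)) = V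
    rw [hV]
    unfold descendTo
    rw [ht, hB]
    congr 1
    funext c
    rw [Pi.zero_apply, mul_zero, AbelianEML.gexp_zero, mul_one]
  -- … and in the open regular space (6)
  have hregU : RegPr F n K e U := ((mem_regFibrePr_iff F).mp hreg).2
  obtain ⟨δ, hδ, hball⟩ := exists_ball_subset_regPr F n K e U hregU
  have hcont : ∀ b : PBond (F.P K) 0, ∀ᶠ t in 𝓝 (0 : ℝ),
      ‖((expChart U (t • X) b : Matrix.specialUnitaryGroup (Fin 2) ℂ) : Matrix (Fin 2) (Fin 2) ℂ) - ((U b : Matrix.specialUnitaryGroup (Fin 2) ℂ) : Matrix (Fin 2) (Fin 2) ℂ)‖ < δ := by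
    intro b
    have hc : ContinuousAt (fun t : ℝ => ((expChart U (t • X) b : Matrix.specialUnitaryGroup (Fin 2) ℂ) : Matrix (Fin 2) (Fin 2) ℂ)) 0 :=
      (hasDerivAt_coe_expChart_along (U := U) (c := fun t : ℝ => t • X) (hasDerivAt_ray X) (zero_smul ℝ X) b).continuousAt
    have h0 : ‖((expChart U ((0 : ℝ) • X) b : Matrix.specialUnitaryGroup (Fin 2) ℂ) : Matrix (Fin 2) (Fin 2) ℂ) -
        ((U b : Matrix.specialUnitaryGroup (Fin 2) ℂ) : Matrix (Fin 2) (Fin 2) ℂ)‖ < δ := by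
      rw [zero_smul, expChart_zero, sub_self, norm_zero]; exact hδ
    exact ((hc.sub continuousAt_const).norm).eventually_lt continuousAt_const h0
  have hregT : ∀ᶠ t in 𝓝 (0 : ℝ), RegPr F n K e (expChart U (t • X)) :=
    (eventually_all.2 hcont).mono fun t ht => hball _ ht
  -- the line is diagonal, so the minimiser property gives a local minimum of the action along it
  have hlocmin : IsLocalMin (fun t : ℝ => wilsonAction4 (expChart U (t • X))) 0 := by
    refine (hfib.and hregT).mono fun t ht => ?_
    show wilsonAction4 (expChart U ((0 : ℝ) • X)) ≤ wilsonAction4 (expChart U (t • X))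
    rw [zero_smul, expChart_zero]
    refine hmin _ (fun b => ?_) ((mem_regFibrePr_iff F).mpr ⟨ht.1, ht.2⟩)
    rw [hray t]
    exact commute_coe_gexpAt_sigma3 _ b
  -- Fermat
  obtain ⟨a', ha'⟩ : ∃ a' : ℝ, HasDerivAt (fun t : ℝ => wilsonAction4 (expChart U (t • X))) a' 0 :=
    ⟨_, hasDerivAt_wilsonAction4 (fun b => hasDerivAt_coe_expChart_along (U := U) (c := fun t : ℝ => t • X) (hasDerivAt_ray X) (zero_smul ℝ X) b)
      fun p => hasDerivAt_coe_plaqHol (fun b => hasDerivAt_coe_expChart_along (U := U) (c := fun t : ℝ => t • X) (hasDerivAt_ray X) (zero_smul ℝ X) b) p⟩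
  have ha0 : a' = 0 := hlocmin.hasDerivAt_eq_zero ha'
  rw [ha0] at ha'
  exact ha'

/-- ★★★ **THE LETTERING-FREE `hEL` EDITION**: a σ₃-diagonal `W ∈ regFibrePr F n K e V` (`0 < e` with the admissibility rows `143·(49∕4)²·e ≤ 1∕3`, `2e ≤ 2δ₂∕(7L)²`) minimising
the Wilson action among the σ₃-DIAGONAL members of `regFibrePr F n K e V` is E–L-critical along EVERY bond-wise differentiable fibre curve — ✓`orbitGrowth_of_regular_five`'s ∕
✓pen 7's `hEL` binder VERBATIM.  NO lettering, NO loop-sum guard (compare ✓FILE 2 `el_of_abelianMin`). [cite: Balaban1985Variational, (2)-(6) p.278, (82)-(83) p.290, (111) p.294; Balaban1987RG1, (0.4)+(0.11) p.253] -/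
theorem el_of_abelianMin_free (h : n ≤ K) {e : ℝ} (he : 0 < e) (hr3 : (143 * ((((3 + 4 : ℕ) : ℝ)) ^ 2 / 4) ^ 2) * e ≤ 1 / 3)
    (hr2 : 2 * e ≤ 2 * deltaSU (Fin 2) / (((3 + 4) * F.L : ℕ) : ℝ) ^ 2)
    {V : GaugeField (F.P n) 0 (Matrix.specialUnitaryGroup (Fin 2) ℂ)} {W : GaugeField (F.P K) 0 (Matrix.specialUnitaryGroup (Fin 2) ℂ)}
    (hW : ∀ b, Commute ((W b : Matrix.specialUnitaryGroup (Fin 2) ℂ) : Matrix (Fin 2) (Fin 2) ℂ) σ₃)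
    (hreg : W ∈ regFibrePr F n K h e V)
    (hmin : ∀ W' : GaugeField (F.P K) 0 (Matrix.specialUnitaryGroup (Fin 2) ℂ),
      (∀ b, Commute ((W' b : Matrix.specialUnitaryGroup (Fin 2) ℂ) : Matrix (Fin 2) (Fin 2) ℂ) σ₃) → W' ∈ regFibrePr F n K h e V → wilsonAction4 W ≤ wilsonAction4 W') :
    ∀ γ : ℝ → GaugeField (F.P K) 0 (Matrix.specialUnitaryGroup (Fin 2) ℂ), γ 0 = W → (∀ t, γ t ∈ fibre F ℰp n K h V) →
      (∀ b, DifferentiableAt ℝ (fun t => ((γ t b : Matrix.specialUnitaryGroup (Fin 2) ℂ) : Matrix (Fin 2) (Fin 2) ℂ)) 0) →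
        deriv (fun t => wilsonAction4 (γ t)) 0 = 0 := by
  have hk : K - n ≤ (F.P K).m + (F.P K).K := by show K - n ≤ F.m + K; omega
  obtain ⟨ht₀, hstδ, hsm⟩ := smallness_of_regPr F he hr3 hr2 ((mem_regFibrePr_iff F).mp hreg).2
  intro γ hγ0 hγfib hγd
  by_cases hdiff : DifferentiableAt ℝ (fun t => wilsonAction4 (γ t)) 0
  · have ha := hdiff.hasDerivAt
    have hfib : ∀ᶠ t in 𝓝 (0 : ℝ), Averaging.iter (fun i => blockAvg (P := F.P K) (j := i) (expMeanLogSU (n := Fin 2))) (K - n) (γ t) =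
        Averaging.iter (fun i => blockAvg (P := F.P K) (j := i) (expMeanLogSU (n := Fin 2))) (K - n) W := by
      refine Filter.Eventually.of_forall fun t => ?_
      have h1 : descendTo F ℰp n K h (γ t) = descendTo F ℰp n K h (γ 0) := by
        have ht : descendTo F ℰp n K h (γ t) = V := hγfib t
        have h0 : descendTo F ℰp n K h (γ 0) = V := hγfib 0
        rw [ht, h0]
      rw [hγ0] at h1
      unfold descendTo at h1
      have h2 := congrArg (fieldShift (G := Matrix.specialUnitaryGroup (Fin 2) ℂ)
        (F.sitesPerDir_eq (m := F.m) (K := n) (j := 0) (m' := F.m) (K' := K) (j' := K - n) (by omega)).symm) h1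
      rw [fieldShift_fieldShift_symm, fieldShift_fieldShift_symm] at h2
      exact h2
    exact curveCritical_of_abelianTangentCritical hk ht₀ hstδ hsm hW
      (abelianTangentCritical_of_abelianMin_free F h ht₀ hstδ hW hsm hreg hmin) γ hγ0 (differentiableAt_pi.2 hγd) hfib ha
  · exact deriv_zero_of_not_differentiableAt hdiff

end Supplier

end Summit.QuantumFields.YangMills.Theorems.FluctuationComparisonRegPrIntLS2BetaAbelianCriticalOfMinFree

end
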